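import Literature.NumberTheory.Automorphic.Liu2021.LemD1IsotropyOfPlace
import HarnessLib

/-!
# `hD1''` line `a4-liuD1pp`, stub (5) `stub_isotropic_of_three_le : IsotropyRankThree` — CLOSED IN THE TREE, BY NAME
# (cell `hodgecm-mathlib`, fan A ↔ fan B junction for the binder `HypD1pp` = stmt-HodgeConjecture-24838)

Summits side, binder subdirectory `CorCM/HypD1pp/`.  The crux skeleton `A-plan/lines/a4-liuD1pp.lean` (sha16 2ff805ec0320d57a,
REF1 PASS 2026-08-28T01:22:16Z, namespace `Summit.HodgeConjecture.CorCM.Lines.A4LiuD1pp`) cuts the binder `hD1''`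
(= [Liu2021, Lem. D.1, first sentence + (1)] AS PRINTED, per admissible index and finite place, at the face datum) into six stubs;
its stub (5) is fan B's stub (5) of line `b4-lemD1-item1-at-v` CLOSED OVER ITS VARIABLE BLOCK as the Prop
`PerPlace.IsotropyRankThree`: «for every quadratic `E/F`, frame, line `a`, family `𝓢`, `n ≥ 3`, characters `μ, χ₁` and finite
place `v`, the hermitian space `(E_vⁿ, J_V ⊗ (a))` of the as-printed local datum `localLemD1Data … v` is NOT anisotropic».

This file PROVES that statement, VERBATIM (the `∀`-closed body of `PerPlace.IsotropyRankThree`, binders in B's `variable` order),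
from the tree theorem `Literature.NumberTheory.Automorphic.Liu2021.Def411WeilCarriers.not_isAnisotropic_localLemD1Data`
(fan B, line `b4-isotropy-rank-three`, `Literature/NumberTheory/Automorphic/Liu2021/LemD1IsotropyOfPlace.lean`, p590822): trace form
`x ↦ Tr_{E_v/F_v} h(x,x)` on the `2n ≥ 6`-dimensional `F_v`-space `E_vⁿ` [MoeglinVignerasWaldspurger1987, Chap. 1 I.1] + u-invariant
`u(F_v) = 4` [Lam2005, Ch. VI Thm 2.12] (tree `QuadraticForms.not_anisotropic_of_five_le_finrank_adicCompletion`, p590340).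
So at crux-write time the A-side stub closes by `:= Summit.HodgeConjecture.CorCM.HypD1pp.isotropyRankThree` after
`import Summits.HodgeConjecture.CorCM.HypD1pp.A4LiuD1ppIsotropyRankThree`.

HC_CM is proved only modulo the 7 printed citations (`hDel`, `h21`, `hLiu418`, `h411`, `h413`, `hD3`, `hD1''`) until rung 0 closes;
this file discharges no binder by itself (stubs (1) IV-1a and (4) = IV-3(a)(b) of the line remain open).

## References
* [Liu2021] Y. Liu, Camb. J. Math. 9 (2021) = arXiv:2102.11518, App. D Lemma D.1 (1), l. 5229 («unless `V` is anisotropic (in particular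
  `n = 2`)»), proof l. 5249–5266.
* [MoeglinVignerasWaldspurger1987] C. Mœglin, M.-F. Vignéras, J.-L. Waldspurger, LNM 1291, Chap. 1 I.1; Chap. 3 IV.2.
* [Lam2005] T. Y. Lam, *Introduction to quadratic forms over fields*, GSM 67, Ch. VI Thm 2.12.
* [Serre1973] J.-P. Serre, *A Course in Arithmetic*, Ch. IV §2.3 Thm 6.
-/

set_option autoImplicit false

noncomputable section

namespace Summit.HodgeConjecture.CorCM.HypD1pp

open scoped Matrix Kronecker TensorProduct Classical RestrictedProduct
open NumberField NumberField.mixedEmbedding IsDedekindDomain Filter Set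
open Literature.NumberTheory.Automorphic Literature.NumberTheory.Automorphic.UnitaryGroup
open Literature.NumberTheory.Weil1964 Literature.RepresentationTheory
open Literature.RepresentationTheory.HeisenbergGroup
open Literature.GroupTheory.RestrictedProductCharacter
open Literature.NumberTheory Literature.NumberTheory.GelbartRogawski1991 Literature.NumberTheory.GelbartRogawski1991.UnitaryDualPair
open Literature.NumberTheory.GelbartRogawski1991.UnitaryDualPair.WeilCoinv
open Literature.NumberTheory.Automorphic.Liu2021 Literature.NumberTheory.Automorphic.Liu2021.Def411WeilCarriers
open Literature.RepresentationTheory.CentralCharacterQuotient (augmentation quotRep)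
open Literature.RepresentationTheory.MoeglinVignerasWaldspurger1987
open MeasureTheory

/-- **Line `a4-liuD1pp`, stub (5) `IsotropyRankThree`, PROVED** — hermitian spaces of rank `n ≥ 3` over `E_v` are isotropic: for
every quadratic extension `E/F` of number fields with `c δ = -δ`, every frame `J_V = T_V ⊗ 1` (`T_V` symmetric with unit determinant),
line `a`, family of local splittings `𝓢`, `3 ≤ n`, characters `μ_v` and `χ₁`, and every finite place `v` of `F`, the local datum
`localLemD1Data … v` of [Liu2021, Lem. D.1] is NOT anisotropic (the printed exception «`V` anisotropic (in particular `n = 2`)» never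
occurs for `n ≥ 3`).  Statement = the body of `Summit.HodgeConjecture.CorCM.Lines.A4LiuD1pp.PerPlace.IsotropyRankThree`
(a4-liuD1pp.lean 2ff805ec0320d57a), character for character; proof = fan B's
`Def411WeilCarriers.not_isAnisotropic_localLemD1Data` (trace form over `F_v` in `2n ≥ 6` variables + `u(F_v) = 4`).
[cite: Liu2021, App. D Lemma D.1 (1)] [cite: MoeglinVignerasWaldspurger1987, Chap. 1 I.1] [cite: Lam2005, Ch. VI Thm 2.12]
[cite: Serre1973, Ch. IV §2.3 Thm 6] -/
theorem isotropyRankThree :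
    ∀ (F E : Type) [Field F] [NumberField F] [Field E] [NumberField E] [Algebra F E]
    (c : E ≃ₐ[F] E) (N : ℕ) {n : ℕ} (e : Fin N × Fin 1 ≃ Fin n)
    (JV : Matrix (Fin N) (Fin N) E) {TV : Matrix (Fin N) (Fin N) F}
    [Algebra.IsQuadraticExtension F E] {δ : E} (hcδ : c δ = -δ) (hδ : δ ≠ 0) {d : F}
    (hd : δ * δ = algebraMap F E d) (hV : TV.IsSymm) (hVd : IsUnit TV.det) (hJV : JV = TV.map (algebraMap F E))
    (a : Fˣ)
    (𝓢 : LocalSplitting.FinLocalSplittings F E c n hcδ hδ hd (gram F e TV (TW F a)) (isSymm_gram F e hV (isSymm_TW F a))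
      (reindex_kronecker_eq_gram_map F E e hJV (JW_eq F E a)))
    (hn : 3 ≤ n)
    (μ : ∀ v : HeightOneSpectrum (𝓞 F), (LocalRing E v)ˣ →* ℂˣ) (hμn : ∀ v x, ‖((μ v x : ℂˣ) : ℂ)‖ = 1)
    (hμc : ∀ v, Continuous fun x => ((μ v x : ℂˣ) : ℂ))
    (hμF : ∀ (v : HeightOneSpectrum (𝓞 F)) (t : (v.adicCompletion F)ˣ),
      μ v (Units.map (algebraMap (v.adicCompletion F) (LocalRing E v)).toMonoidHom t) = 1 ↔
        ∃ x : (LocalRing E v)ˣ, (x : LocalRing E v) * conjLocal E c v x = algebraMap (v.adicCompletion F) (LocalRing E v) t)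
    (χ₁ : UnitaryGroup.finAdelicOne F E c →* ℂˣ) (hχ₁n : ∀ u, ‖((χ₁ u : ℂˣ) : ℂ)‖ = 1) (hχ₁c : Continuous χ₁)
    (v : HeightOneSpectrum (𝓞 F)),
    ¬ (localLemD1Data F E c N e JV hcδ hδ hd hV hVd hJV a 𝓢 hn μ hμn hμc hμF χ₁ hχ₁n hχ₁c v).IsAnisotropic :=
  fun F E _ _ _ _ _ c N _ e JV _ _ _ hcδ hδ _ hd hV hVd hJV a 𝓢 hn μ hμn hμc hμF χ₁ hχ₁n hχ₁c v =>
    not_isAnisotropic_localLemD1Data F E c N e JV hcδ hδ hd hV hVd hJV a 𝓢 hn μ hμn hμc hμF χ₁ hχ₁n hχ₁c v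

end Summit.HodgeConjecture.CorCM.HypD1pp

end
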